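import Summits.QuantumFields.YangMills.Theses.MirrorModularBoosts
import Summits.QuantumFields.YangMills.Theorems.PencilRigidityCurvatureChannel

/-!
# `MirrorModularBoosts.CurvatureChannel` (stmt-QuantumFields-9666): the shared item, route-local name

The support item `CurvatureChannel` (stmt-QuantumFields-9666) is SHARED VERBATIM by the routes
`PencilRigidity` and `MirrorModularBoosts`; the gate renders one copy of the declaration in each
route file. It is proved in `Theorems/PencilRigidityCurvatureChannel.lean`
(`Summit.QuantumFields.YangMills.Theorems.curvatureChannel_proof`); this file records the proof
under the `MirrorModularBoosts` name of the declaration (the two definientia are identical, so the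
terms are definitionally equal).
-/

namespace Summit.QuantumFields.YangMills.Theorems

/-- **`MirrorModularBoosts.CurvatureChannel` holds** (item stmt-QuantumFields-9666): the
curvature channel of a labelled family with the `HypercubicLimit` clauses carries the one-species
package `W₁` and is reflection positive in pull-back form for the four axis frames — the verbatim
twin of `PencilRigidity.CurvatureChannel`, by `curvatureChannel_proof`. -/
theorem mirrorModularBoosts_curvatureChannel_proof :
    Summit.QuantumFields.YangMills.Theses.MirrorModularBoosts.CurvatureChannel :=
  curvatureChannel_proof

end Summit.QuantumFields.YangMills.Theorems
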